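import Summits.CriticalPhenomena.PercolationContinuityZ3.Theorems.FK.SamePContinuationPinned
import Summits.CriticalPhenomena.PercolationContinuityZ3.Theorems.FK.Transplant.FHSlabPercolationTools
import Summits.CriticalPhenomena.PercolationContinuityZ3.Theorems.FK.Transplant.KNFreeTheorem6Sound
import Summits.CriticalPhenomena.PercolationContinuityZ3.Theorems.FK.Transplant.UFSC0SlabBoxLawful
import HarnessLib

/-!
# FRONTIER TRANSPLANT — K1 in finite form (K1-FIN), piece (P1): pinned domination under the FREE law of a FINITE
# region, and the conditional failure bound of a pinned scheme under that law for targets whose fresh edges fit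

Support file (`--supports stmt-CriticalPhenomena-4575`, helper) of the FRONTIER TRANSPLANT sub-cell
(`fk-continuity/transplant/`, seat `prim-bschramm-fkt-p3`); builds on p205010 (kernel theorem, internal audit signed;
external expert review pending). Memo row K1-FIN [g130, R67] (bytes-first package). 0 named facts · 0 sorries ·
standard axioms (no `FH`, no `UFSC0` in this file).
Registered R70 (cell INBOX l.5267, 2026-08-23); registry row T4k; lead label T4k-06 (fkt-lead L44, l.5255).

HONEST FRAMING (page 1, cell rule). The transplant's theorem of record `ufsc0_of_freeBoundaryHypothesis_r3` is
CONDITIONAL on FH AND on TP_FK, both OPEN at the same `p` for `q > 1` (⇔ GRC Conj. (5.103) via K1; barrier note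
`Literature.Barriers.CriticalPhenomena.SamePFreeBoundaryCriteria`, FBN-01); the transplant is a typed reduction, not a
proof of FK continuity. K1-FIN (`(∃ r, UFSC0) ⟹ (∃ L, Π(p, L))`) changes nothing in the record (`_r3` « 2 / 0 ☑ »,
n_open = 2).

## What is here (namespace `Summit.CriticalPhenomena.PercolationContinuityZ3.Theorems.FK`)

The cell's C2 chain supplies the `dom` clause of the conditional driver under an INFINITE-volume free box limit
(`IsBoxLimit.real_inter_le_fkLaw_mul`, `SameP.PinnedLawful.dom`). K1-FIN runs the exploration under the free
random-cluster law `φ⁰_{Λ,p,q}` of a FINITE region `Λ` (a slab box), read on `ℤ^d`: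

* `SameP.regionFreeReal_inter_le_fkLaw_mul` — Grimmett's Lemma (4.13) + (4.14)(b)/(3.22) for `φ⁰_{Λ,p,q}` and a
  region `R ⊆ Λ` (the tree's box case `SameP.rcBoxLaw_real_inter_le_fkLaw_mul` with `Λ_n ↦ Λ`);
* `SameP.regionFreeReal_inter_le_fkLaw_mul_of_fresh` — the same for an ARBITRARY region `R` provided only the FRESH
  edges `F` lie inside `Λ` (the explored region may stick out of `Λ`: its pairs are pinned; a pinned-open pair outside
  `Λ` makes the conditioning event null);
* `fkLaw_restrW_lattW_real_eq_regionFreeReal`, `fkLaw_restrW_lattW_ae_subset_edgeSet` — the free law of `Λ` as the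
  transplant's `fkLaw Λ (restrW Λ (lattW p)) q`;
* **`SameP.PinnedLawful.condLawfulOn_fkLaw`** — a pinned robustly lawful scheme (C3b's `knScheme`, via
  `fkRobustLawful_knScheme`) is `CondLawfulOn` (file (P2c-i)) under the free law of `Λ` at the scheme's own `p`, with
  `ε` its pinned failure bound, ON every set of targets whose examinations have all their fresh edges inside `Λ`.

## References

* G. Grimmett, *The Random-Cluster Model*, Springer 2006: Lemma (4.13), Lemma (4.14)(b), Thm. (3.21) eq. (3.22),
  Thm. (3.7) [Grimmett2006].
* G. Kozma, S. Nitzan, arXiv:2401.12397 (2024), §4 p. 25 ((4)), p. 28 ((33)) [KozmaNitzan2024].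
-/

noncomputable section

namespace Summit.CriticalPhenomena.PercolationContinuityZ3.Theorems.FK

open MeasureTheory Literature.Probability.Percolation Literature.Probability.LatticeModels
open Literature.Probability.Percolation.ProbeHistory Literature.Probability.Percolation.HSiteScheme
open Literature.Probability.Percolation.KozmaNitzan
open Literature.Probability.Percolation.GadgetSystem (tgt)
open scoped ENNReal Classical

namespace SameP

variable {d : ℕ}

/-! ### §1 Pinned domination under the free law of a finite region -/

/-- **Pinned domination under the free law of a finite region** (Grimmett 2006, Lemma (4.13) + (4.14)(b)/(3.22), for the
free measure `φ⁰_{Λ,p,q}` of ANY finite `Λ ⊆ ℤ^d` read on `ℤ^d` through `regionFreeReal`): with `R ⊆ Λ`, `F` (fresh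
lattice edges), `I` (pinned-open pairs), weights `W` as in `rcBoxLaw_real_inter_le_fkLaw_mul`, `D` decreasing determined
by `F`, `H` determined by `T` disjoint from `F` with `I` open on `H`:
`φ⁰_{Λ}(D ∩ H) ≤ (fkLaw R W q)(D) · φ⁰_{Λ}(H)`. The proof is the box proof with `Λ_n ↦ Λ`.
[cite: Grimmett2006, Lemma (4.13) and Lemma (4.14)(b)] -/
theorem regionFreeReal_inter_le_fkLaw_mul {p q : ℝ} (hp : p ∈ Set.Icc (0 : ℝ) 1) (hq : 1 ≤ q)
    {Λ R : Finset (Site d)} (hR : R ⊆ Λ) (W : Sym2 (Site d) → unitInterval)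
    (F I T : Finset (Sym2 (Site d))) (hF : (↑F : Set (Sym2 (Site d))) ⊆ (zdGraph d).edgeSet)
    (hWF : ∀ e ∈ F, (W e : ℝ) ≤ p) (hWI : ∀ e ∉ F, W e ≠ 0 → e ∈ I) (hWR : ∀ e, W e ≠ 0 → ∀ x ∈ e, x ∈ R)
    {D H : Set (BondConfig (Site d))} (hD : IsLowerSet D) (hDF : DeterminedBy D ↑F)
    (hHT : DeterminedBy H ↑T) (hTF : Disjoint T F) (hHI : H ⊆ {ω | (↑I : Set (Sym2 (Site d))) ⊆ ω}) :
    regionFreeReal d p q Λ (D ∩ H) ≤ (fkLaw R W q).real D * regionFreeReal d p q Λ H := by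
  have hq0 : 0 < q := one_pos.trans_le hq
  have hDm : MeasurableSet D := hDF.measurableSet_of_finset
  set w : Sym2 ↥Λ → unitInterval := edgeIndicatorWeights (finsetGraph (zdGraph d) Λ) ⟨p, hp⟩ with hw
  set w' : Sym2 ↥Λ → unitInterval := fun e => W (Sym2.map Subtype.val e) with hw'
  -- the free region measure is the edge-parameter measure with indicator weights
  have hfree : rcMeasure (finsetGraph (zdGraph d) Λ) p q (∅ : Set ↥Λ) = rcMeasureW w q (∅ : Set ↥Λ) :=
    rcMeasure_eq_rcMeasureW (finsetGraph (zdGraph d) Λ) ⟨p, hp⟩ hq0 ∅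
  have hreal : ∀ A : Set (BondConfig (Site d)),
      regionFreeReal d p q Λ A = (rcMeasureW w q (∅ : Set ↥Λ)).real (liftEdges Λ ⁻¹' A) := by
    intro A
    rw [regionFreeReal, hfree]
  -- the revealed set of the region: every pair NOT over `F`
  set S : Finset (Sym2 ↥Λ) := Finset.univ.filter fun e => Sym2.map Subtype.val e ∉ F with hS
  have hScompl : (↑S : Set (Sym2 ↥Λ))ᶜ = overPairs Λ ↑F := by
    ext e; simp [hS, overPairs]
  -- pulled-back events
  set D' := liftEdges Λ ⁻¹' D with hD'
  set H' := liftEdges Λ ⁻¹' H with hH'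
  have hD'low : IsLowerSet D' := isLowerSet_preimage_liftEdges Λ hD
  have hH'det : DeterminedBy H' (↑S : Set (Sym2 ↥Λ)) := by
    refine (determinedBy_preimage_liftEdges (Λ := Λ) hHT).mono fun e he => ?_
    rw [mem_overPairs] at he
    simp only [hS, Finset.coe_filter, Finset.mem_univ, true_and, Set.mem_setOf_eq]
    exact fun heF => Finset.disjoint_left.1 hTF he heF
  -- domain Markov: sum over the patterns on `S` realising `H'`
  haveI : ∀ ξ : Finset (Sym2 ↥Λ),
      IsProbabilityMeasure (rcMeasureW (condWeights w (↑S : Set (Sym2 ↥Λ))ᶜ ↑ξ) q (∅ : Set ↥Λ)) :=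
    fun ξ => isProbabilityMeasure_rcMeasureW _ hq0 ∅
  have hsumD := rcMeasureW_real_inter_eq_sum_pattern w hq0 (∅ : Set ↥Λ) S D' hH'det
  have hsum1 := rcMeasureW_real_inter_eq_sum_pattern w hq0 (∅ : Set ↥Λ) S Set.univ hH'det
  rw [Set.univ_inter] at hsum1
  simp only [probReal_univ, mul_one] at hsum1
  -- per pattern: the conditional weights dominate `w'`, so the decreasing `D'` is more likely under `w'`
  have hterm : ∀ ξ ∈ S.powerset.filter (fun T : Finset (Sym2 ↥Λ) => (↑T : Set (Sym2 ↥Λ)) ∈ H'),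
      (rcMeasureW (condWeights w (↑S : Set (Sym2 ↥Λ))ᶜ ↑ξ) q (∅ : Set ↥Λ)).real D' ≤
        (rcMeasureW w' q (∅ : Set ↥Λ)).real D' := by
    intro ξ hξ
    have hξH : (↑ξ : Set (Sym2 ↥Λ)) ∈ H' := (Finset.mem_filter.1 hξ).2
    have hIξ : ∀ e : Sym2 ↥Λ, Sym2.map Subtype.val e ∈ I → e ∈ ξ := by
      intro e he
      have hsub := hHI hξH
      have : Sym2.map Subtype.val e ∈ liftEdges Λ ↑ξ := hsub (Finset.mem_coe.2 he)
      exact Finset.mem_coe.1 (map_mem_liftEdges_iff.1 this)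
    refine rcMeasureW_real_anti_weights_of_isLowerSet (fun e => Subtype.coe_le_coe.1 ?_) hq ∅ hD'low
    rw [hScompl]
    simp only [hw', condWeights]
    by_cases heF : e ∈ overPairs Λ ↑F
    · rw [if_pos heF]
      have heF' : Sym2.map Subtype.val e ∈ F := heF
      have hadj : e ∈ (finsetGraph (zdGraph d) Λ).edgeSet := by
        induction e using Sym2.ind with
        | h x y =>
          rw [SimpleGraph.mem_edgeSet, finsetGraph_adj_iff]
          exact (SimpleGraph.mem_edgeSet _).1 (hF (by simpa using heF'))
      have hwe : w e = ⟨p, hp⟩ := by simp [hw, edgeIndicatorWeights, hadj]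
      rw [hwe]
      exact hWF _ heF'
    · rw [if_neg heF]
      by_cases hW0 : W (Sym2.map Subtype.val e) = 0
      · rw [hW0]
        split_ifs
        · simp
        · simp
      · have heI : e ∈ (↑ξ : Set (Sym2 ↥Λ)) := Finset.mem_coe.2 (hIξ e (hWI _ heF hW0))
        rw [if_pos heI]
        simpa using (W (Sym2.map Subtype.val e)).2.2
  -- assemble
  calc regionFreeReal d p q Λ (D ∩ H)
      = (rcMeasureW w q (∅ : Set ↥Λ)).real (D' ∩ H') := by rw [hreal, Set.preimage_inter]
    _ = ∑ ξ ∈ S.powerset.filter (fun T : Finset (Sym2 ↥Λ) => (↑T : Set (Sym2 ↥Λ)) ∈ H'),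
          (rcMeasureW w q (∅ : Set ↥Λ)).real {ω | ω ∩ ↑S = ↑ξ} *
            (rcMeasureW (condWeights w (↑S : Set (Sym2 ↥Λ))ᶜ ↑ξ) q (∅ : Set ↥Λ)).real D' := hsumD
    _ ≤ ∑ ξ ∈ S.powerset.filter (fun T : Finset (Sym2 ↥Λ) => (↑T : Set (Sym2 ↥Λ)) ∈ H'),
          (rcMeasureW w q (∅ : Set ↥Λ)).real {ω | ω ∩ ↑S = ↑ξ} * (rcMeasureW w' q (∅ : Set ↥Λ)).real D' :=
        Finset.sum_le_sum fun ξ hξ => mul_le_mul_of_nonneg_left (hterm ξ hξ) measureReal_nonneg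
    _ = (rcMeasureW w' q (∅ : Set ↥Λ)).real D' * (rcMeasureW w q (∅ : Set ↥Λ)).real H' := by
        rw [← Finset.sum_mul, mul_comm, ← hsum1]
    _ = (fkLaw R W q).real D * regionFreeReal d p q Λ H := by
        rw [hD', rcMeasureW_box_real_preimage_eq_fkLaw hR W hWR hq0 hDm, hreal]

/-- `regionFreeReal` is monotone (it is a probability measure read on pulled-back events). [folklore] -/
theorem regionFreeReal_mono_of_subset {p q : ℝ} (hp : p ∈ Set.Icc (0 : ℝ) 1) (hq : 0 < q) (Λ : Finset (Site d))
    {A B : Set (BondConfig (Site d))} (hAB : A ⊆ B) :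
    regionFreeReal d p q Λ A ≤ regionFreeReal d p q Λ B := by
  unfold regionFreeReal
  haveI := isProbabilityMeasure_rcMeasure (finsetGraph (zdGraph d) Λ) hp hq (∅ : Set ↥Λ)
  exact measureReal_mono (Set.preimage_mono hAB)

/-- Under the free law of `Λ`, a pair with an endpoint outside `Λ` is never open. [cite: Grimmett2006, §4.2 (configurations on E_Λ, 0 off Λ)] -/
theorem regionFreeReal_setOf_mem_eq_zero_of_not_mem {p q : ℝ} (Λ : Finset (Site d)) {e : Sym2 (Site d)} {x : Site d}
    (hx : x ∈ e) (hxΛ : x ∉ Λ) : regionFreeReal d p q Λ {ω | e ∈ ω} = 0 := by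
  unfold regionFreeReal
  have hempty : liftEdges Λ ⁻¹' {ω : BondConfig (Site d) | e ∈ ω} = ∅ := by
    ext ω
    simp only [Set.mem_preimage, Set.mem_setOf_eq, Set.mem_empty_iff_false, iff_false, mem_liftEdges_iff,
      not_exists, not_and]
    intro e' _ he'
    subst he'
    obtain ⟨y, hy, hyx⟩ := Sym2.mem_map.1 hx
    exact hxΛ (hyx ▸ y.2)
  rw [hempty, measureReal_empty]

/-- **Pinned domination under the free law of a finite region, for a region sticking out of `Λ`.** As
`regionFreeReal_inter_le_fkLaw_mul`, for an ARBITRARY finite region `R` (not necessarily inside `Λ`), provided the FRESH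
lattice edges `F` lie inside `Λ` (pairs of `R` outside `Λ` are pinned: a pinned-open one makes `H` null under
`φ⁰_{Λ}`, pinned-closed ones carry weight `0`). [cite: Grimmett2006, Lemma (4.13) and Lemma (4.14)(b)] -/
theorem regionFreeReal_inter_le_fkLaw_mul_of_fresh {p q : ℝ} (hp : p ∈ Set.Icc (0 : ℝ) 1) (hq : 1 ≤ q)
    (Λ R : Finset (Site d)) (W : Sym2 (Site d) → unitInterval)
    (F I T : Finset (Sym2 (Site d))) (hF : (↑F : Set (Sym2 (Site d))) ⊆ (zdGraph d).edgeSet)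
    (hFΛ : ∀ e ∈ F, ∀ x ∈ e, x ∈ Λ)
    (hWF : ∀ e ∈ F, (W e : ℝ) ≤ p) (hWI : ∀ e ∉ F, W e ≠ 0 → e ∈ I) (hWR : ∀ e, W e ≠ 0 → ∀ x ∈ e, x ∈ R)
    {D H : Set (BondConfig (Site d))} (hD : IsLowerSet D) (hDF : DeterminedBy D ↑F)
    (hHT : DeterminedBy H ↑T) (hTF : Disjoint T F) (hHI : H ⊆ {ω | (↑I : Set (Sym2 (Site d))) ⊆ ω}) :
    regionFreeReal d p q Λ (D ∩ H) ≤ (fkLaw R W q).real D * regionFreeReal d p q Λ H := by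
  have hq0 : 0 < q := one_pos.trans_le hq
  by_cases hΛ : ∀ e, W e ≠ 0 → ∀ x ∈ e, x ∈ Λ
  · -- all weighted pairs are inside `Λ`: reduce to the region `R ∩ Λ ⊆ Λ`
    have hWR' : ∀ e, W e ≠ 0 → ∀ x ∈ e, x ∈ R ∩ Λ := fun e he x hx =>
      Finset.mem_inter.2 ⟨hWR e he x hx, hΛ e he x hx⟩
    have hfs : FinSupp W (R ∩ Λ) := ⟨fun e ⟨x, hx, hxR⟩ => by
      by_contra hne
      exact hxR (hWR' e hne x hx)⟩
    have heq : fkLaw R W q = fkLaw (R ∩ Λ) W q := fkLaw_eq_of_subset Finset.inter_subset_left hfs hq0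
    rw [heq]
    exact regionFreeReal_inter_le_fkLaw_mul hp hq Finset.inter_subset_right W F I T hF hWF hWI hWR' hD hDF hHT hTF hHI
  · -- a weighted pair sticks out of `Λ`: it is pinned open, so `H` is null
    push Not at hΛ
    obtain ⟨e, hWe, x, hxe, hxΛ⟩ := hΛ
    have heF : e ∉ F := fun heF => hxΛ (hFΛ e heF x hxe)
    have heI : e ∈ I := hWI e heF hWe
    have hH0 : regionFreeReal d p q Λ H = 0 := by
      refine le_antisymm ?_ (regionFreeReal_nonneg p q Λ H)
      calc regionFreeReal d p q Λ H ≤ regionFreeReal d p q Λ {ω | e ∈ ω} :=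
            regionFreeReal_mono_of_subset hp hq0 Λ fun ω hω => hHI hω (Finset.mem_coe.2 heI)
        _ = 0 := regionFreeReal_setOf_mem_eq_zero_of_not_mem Λ hxe hxΛ
    calc regionFreeReal d p q Λ (D ∩ H) ≤ regionFreeReal d p q Λ H := regionFreeReal_mono_of_subset hp hq0 Λ Set.inter_subset_right
      _ = (fkLaw R W q).real D * regionFreeReal d p q Λ H := by rw [hH0, mul_zero]

end SameP

/-! ### §2 The free law of a finite region as the transplant's `fkLaw` -/

variable {d : ℕ}

/-- **The free law of `Λ` read through `fkLaw`**: `fkLaw Λ (restrW Λ (lattW p)) q (A) = φ⁰_{Λ,p,q}(A)` (`regionFreeReal`)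
for measurable `A` (`0 < q`). [cite: Grimmett2006, §1.4 eq. (1.20); §4.2 (4.11)–(4.12) (ξ = 0)] -/
theorem fkLaw_restrW_lattW_real_eq_regionFreeReal (Λ : Finset (Site d)) (p : unitInterval) {q : ℝ} (hq : 0 < q)
    {A : Set (BondConfig (Site d))} (hA : MeasurableSet A) :
    (fkLaw Λ (restrW (↑Λ : Set (Site d)) (lattW d p)) q).real A = regionFreeReal d p q Λ A := by
  rw [fkLaw_real_apply Λ _ q hA, restrW_lattW_comp_sym2Map, ← rcMeasure_eq_rcMeasureW _ p hq, regionFreeReal]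

/-- **Under the free law of `Λ`, almost every configuration consists of lattice edges** (pairs of weight `0` are
a.s. closed; the free weighting vanishes off the lattice edges of `Λ`). [cite: Grimmett2006, Thm. (3.7)] -/
theorem fkLaw_restrW_lattW_ae_subset_edgeSet (Λ : Finset (Site d)) (p : unitInterval) {q : ℝ} (hq : 1 ≤ q) :
    ∀ᵐ ω ∂(fkLaw Λ (restrW (↑Λ : Set (Site d)) (lattW d p)) q), ω ⊆ (zdGraph d).edgeSet := by
  set W := restrW (↑Λ : Set (Site d)) (lattW d p) with hW
  haveI := (isPinningLaw_fkLaw Λ hq).prob W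
  have h0 := fkLaw_real_compl_setOf_weight_zero Λ W hq
  have hnull : (fkLaw Λ W q) {η : BondConfig (Site d) | ∀ x : Sym2 (Site d), W x = 0 → x ∉ η}ᶜ = 0 :=
    (measureReal_eq_zero_iff (measure_ne_top _ _)).1 h0
  rw [ae_iff]
  refine measure_mono_null (fun ω hω => ?_) hnull
  simp only [Set.mem_setOf_eq, Set.mem_compl_iff, not_forall, not_not] at hω ⊢
  rw [Set.not_subset] at hω
  obtain ⟨e, heω, heE⟩ := hω
  refine ⟨e, ?_, heω⟩
  -- a non-edge has free weight `0`
  by_cases hw : e ∈ wireSet (↑Λ : Set (Site d))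
  · rw [hW, restrW_apply_of_mem _ hw]
    induction e using Sym2.ind with
    | h x y =>
      rw [lattW_mk]
      have : ¬(zdGraph d).Adj x y := fun h => heE ((SimpleGraph.mem_edgeSet _).2 h)
      rw [if_neg this]
  · rw [hW, restrW_apply_of_not_mem _ hw]

/-! ### §3 A pinned scheme is conditionally lawful under the free law of `Λ`, on targets whose fresh edges fit -/

namespace SameP

namespace PinnedLawful

variable {S : HSiteScheme (Site d)} {q : ℝ} {p : unitInterval} {ε : ℝ} {N : ℕ}
  {dirs : ProbeHistory (Site d) → Site 2 × MDir → Finset MDir}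
  {reg : ProbeHistory (Site d) → Site 2 × MDir → MDir → Finset (Site d)}
  {bad : ProbeHistory (Site d) → Site 2 × MDir → MDir → Set (BondConfig (Site d))}

/-- **The conditional failure bound of a pinned scheme under the free law of a finite region, when the fresh edges
fit.** Under `μ = fkLaw Λ (restrW Λ (lattW p)) q` (`q ≥ 1`), after every history `h` with a probe along the chosen
edge `e` such that the fresh lattice edges of every region `reg h e du` lie inside `Λ`, the probe fails with conditional
probability at most `ε` given the past: `μ(A₀ ∩ {hist n = h} ∩ {¬succ}) ≤ ε · μ(A₀ ∩ {hist n = h})` (the tree's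
`PinnedLawful.dom` with the finite-region domination `regionFreeReal_inter_le_fkLaw_mul_of_fresh`, then `fail`).
[cite: KozmaNitzan2024, §4 p. 25 ((4)), p. 28 ((33)); Grimmett2006, Lemma (4.13), Lemma (4.14)(b)] -/
theorem fkLaw_real_inter_notSucc_le (hR : PinnedLawful S q p ε N dirs reg bad) (hq : 1 ≤ q) (Λ : Finset (Site d))
    (n : ℕ) {h : ProbeHistory (Site d)} {Pr : AProbe (Site d)} {e : Site 2 × MDir}
    (hPr : S.E.next h = some Pr) (he : (S.mst h).choice = some e)
    (hfit : ∀ du ∈ dirs h e, ∀ e' ∈ freshOf S h (reg h e du), ∀ x ∈ e', x ∈ Λ) :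
    (fkLaw Λ (restrW (↑Λ : Set (Site d)) (lattW d p)) q).real
        (S.initEvent ∩ {ω | S.E.hist n ω = h} ∩ {ω | ¬S.succ h e (Pr.read ω)}) ≤
      ε * (fkLaw Λ (restrW (↑Λ : Set (Site d)) (lattW d p)) q).real (S.initEvent ∩ {ω | S.E.hist n ω = h}) := by
  have hq0 : 0 < q := one_pos.trans_le hq
  set μ := fkLaw Λ (restrW (↑Λ : Set (Site d)) (lattW d p)) q with hμ
  haveI : IsProbabilityMeasure μ := (isPinningLaw_fkLaw Λ hq).prob _
  set H : Set (BondConfig (Site d)) := S.initEvent ∩ {ω | S.E.hist n ω = h} with hH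
  have hHT : DeterminedBy H ↑(S.U₀ ∪ supp h) := by
    rw [Finset.coe_union]
    exact (determinedBy_initEvent.mono Set.subset_union_left).inter
      ((S.E.determinedBy_hist n h).mono Set.subset_union_right)
  have hHm : MeasurableSet H := hHT.measurableSet_of_finset
  have hHI : H ⊆ {ω | (↑(S.U₀ ∪ opens h) : Set (Sym2 (Site d))) ⊆ ω} := by
    rintro ω ⟨hA, hh⟩
    rw [Set.mem_setOf_eq, Finset.coe_union]
    exact Set.union_subset hA (opens_subset_of_hist_eq S.E hh)
  -- per direction: the fresh reduction of the bad event and the finite-region DLR step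
  have hdu : ∀ du ∈ dirs h e, μ.real (bad h e du ∩ H) ≤ (pinnedLaw S q p h (reg h e du)).real (bad h e du) * μ.real H := by
    intro du hdu'
    set R := reg h e du with hRdef
    have hbadm : MeasurableSet (bad h e du) := (hR.determined h e du).measurableSet_of_finset
    have hD'm : MeasurableSet (pinReduce (freshOf S h R) (edgesIn (zdGraph d) R ∩ revealedOf S h ∩ patternOf S h)
        (bad h e du)) := (determinedBy_pinReduce _ _ _).measurableSet_of_finset
    rw [← inter_pinReduce_eq_inter S n h R (hR.determined h e du), ← pinnedLaw_real_pinReduce_eq hq0 (hR.determined h e du),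
      hμ, fkLaw_restrW_lattW_real_eq_regionFreeReal Λ p hq0 (hD'm.inter hHm),
      fkLaw_restrW_lattW_real_eq_regionFreeReal Λ p hq0 hHm]
    exact regionFreeReal_inter_le_fkLaw_mul_of_fresh p.2 hq Λ R (pinnedW S p h R) (freshOf S h R) (S.U₀ ∪ opens h)
      (S.U₀ ∪ supp h) freshOf_subset_edgeSet (hfit du hdu')
      (fun e' he' => by rw [pinnedW_apply_of_mem_freshOf he'])
      (fun e' he' hne => mem_patternOf_of_pinnedW_ne_zero he' hne)
      (fun e' hne => forall_mem_of_pinnedW_ne_zero hne)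
      (isLowerSet_pinReduce _ _ (hR.lower h e du)) (determinedBy_pinReduce _ _ _) hHT disjoint_revealed_freshOf hHI
  calc μ.real (H ∩ {ω | ¬S.succ h e (Pr.read ω)})
      ≤ μ.real (⋃ du ∈ dirs h e, bad h e du ∩ H) := by
        refine measureReal_mono (fun ω hω => ?_) (measure_ne_top _ _)
        obtain ⟨hωH, hωf⟩ := hω
        have := hR.cover h Pr e hPr he hωf
        simp only [Set.mem_iUnion] at this ⊢
        obtain ⟨du, hdu', hωdu⟩ := this
        exact ⟨du, hdu', hωdu, hωH⟩
    _ ≤ ∑ du ∈ dirs h e, μ.real (bad h e du ∩ H) := measureReal_biUnion_finset_le _ _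
    _ ≤ ∑ du ∈ dirs h e, (pinnedLaw S q p h (reg h e du)).real (bad h e du) * μ.real H := Finset.sum_le_sum hdu
    _ = (∑ du ∈ dirs h e, (pinnedLaw S q p h (reg h e du)).real (bad h e du)) * μ.real H := by rw [Finset.sum_mul]
    _ ≤ ε * μ.real H := mul_le_mul_of_nonneg_right (hR.fail h Pr e hPr he) measureReal_nonneg

/-- **A pinned robustly lawful scheme is conditionally lawful under the free law of a finite region `Λ`, ON every set
of targets whose examinations have their fresh edges inside `Λ`** (file (P2c)'s `CondLawfulOn`; `q ≥ 1`; at the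
scheme's own parameter `p`; `ε` the pinned failure bound). With `fkRobustLawful_knScheme` (C3b) this is the input of
the point-to-point driver for Kozma–Nitzan's scheme under the finite free slab law.
[cite: KozmaNitzan2024, §4 p. 25 ((3)–(4)), pp. 28–31 ((33)); Grimmett2006, Lemma (4.13), Lemma (4.14)(b)] -/
theorem condLawfulOn_fkLaw (hR : PinnedLawful S q p ε N dirs reg bad) (hq : 1 ≤ q) (Λ : Finset (Site d))
    (good : Set (Site 2))
    (hgood : ∀ (h : ProbeHistory (Site d)) (Pr : AProbe (Site d)) (e : Site 2 × MDir),
      S.E.next h = some Pr → (S.mst h).choice = some e → tgt e ∈ good →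
        ∀ du ∈ dirs h e, ∀ e' ∈ freshOf S h (reg h e du), ∀ x ∈ e', x ∈ Λ) :
    CondLawfulOn S (fkLaw Λ (restrW (↑Λ : Set (Site d)) (lattW d p)) q) (zdGraph d) ε good where
  probes := hR.probes
  ae_subset := fkLaw_restrW_lattW_ae_subset_edgeSet Λ p hq
  fail n h Pr e hPr he hge := hR.fkLaw_real_inter_notSucc_le hq Λ n hPr he (hgood h Pr e hPr he hge)

end PinnedLawful

end SameP

end Summit.CriticalPhenomena.PercolationContinuityZ3.Theorems.FK

end
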